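import Literature.Geometry.Lorentzian.CarterSuperradiantRegimeKernel
import Literature.Geometry.Lorentzian.CarterSuperradiantKernelBookkeeping
import Literature.Geometry.Lorentzian.CarterSuperradiantDepth
import Literature.Geometry.Lorentzian.CarterLayerBookkeeping
import HarnessLib

/-!
# The superradiant BF-stable cone kernel bound for Carter's equation, Λ-polynomial constants
# (u-language, tortoise variable)
(namespace `Literature.Geometry.Lorentzian.Kerr`.)

The superradiant companion of `CarterSliverCorePoly.sliverRegime_corePoly`: for the horizon- and
infinity-normalised solutions of Carter's radial equation `u″ + (ω² − V(ρ x))u = 0` (DRSR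
arXiv:1402.7034 §5.2.3) at the admissible frequencies of the near-extremal threshold cone with `0 < m`,
in the SUPERRADIANT regime `ω(ω − mω₊) ≤ 0`, `2ξ₁κ ≤ |ω − mω₊|`, and in a Breitenlohner–Freedman-stable
sector with margin `(1 + θ₁)(2r₊ω)² ≤ Λ − 2amω`, for `Λ > Λ₀`:

  `‖u_𝓗(x)‖ · ‖u_𝓘(x′)‖ ≤ C · Λ^N · κ^{−N} · ‖u_𝓗 u_𝓘′ − u_𝓘 u_𝓗′‖(x)`,  `x ≤ x′`,

with `Λ₀, a₁, ε₀, C, N` depending only on `(M, ξ₁, θ₁)`, GIVEN the census as a hypothesis: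

* `superradiantRegime_corePoly`.

Assembly: `superradiant_kernel_le` (explicit constant: sharp cap envelope, κ-free far envelope, and
depth + ALL rates of the barrier basis from the κ-free good zone), the κ-free depth
`superradiantDepth_of_large` (`exists_forall_mul_pow_le_sinh` with `c = θ₁′²/1200`), the cone smallness
`sigma_sq_le_of_cone_margin_sharp` (`ε₀ ≤ θ₁′²/(1088M)`), `abs_sigma_le_abs_omega_of_cone`,
`lambdaPrime_ge_of_margin` (`Λ₀ ≥ 256·89600/θ₁′³`), and the bookkeeping `coneMaster_bounds` (`δ = 2ξ₁`),
`superradiantKernelConstant_le_pow` (`N = 545`); `θ₁′ = min(θ₁, 1)`. Near-extremal Kerr programme, crux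
`KappaExplicitWaveDecay`.

## References
* M. Dafermos, I. Rodnianski, Y. Shlapentokh-Rothman, arXiv:1402.7034 = Ann. of Math. 183 (2016),
  §8 (key `DafermosRodnianskiShlapentokhrothman2014`).
* R. Teixeira da Costa, Commun. Math. Phys. 378 (2020), Prop. 2.20 (key `Costa2019`). Folklore assembly.
-/

noncomputable section

open Filter Set Literature.Analysis.ODE
open scoped _root_.Topology _root_.ComplexConjugate

namespace Literature.Geometry.Lorentzian

namespace Kerr

section SuperradiantCorePoly

variable {M a ω Λ : ℝ} {m : ℤ}

-- adapted from Summits/FinalStateConjecture/FinalStateConjecture/Theorems/PhaseMixingCaptureKappaExplicitWaveDecayFluxRegimeCorePoly.lean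
/-- In the cone `|σ| ≤ m/(16M)` with `m² ≤ Λ`: `σ²M² ≤ Λ`. [folklore] -/
private theorem sigma_sq_mul_sq_le' {σ M Λ : ℝ} {m : ℤ} (hM : 0 < M) (hσm : |σ| ≤ m / (16 * M))
    (hmΛ : (m : ℝ) ^ 2 ≤ Λ) : σ ^ 2 * M ^ 2 ≤ Λ := by
  have h0 : 0 ≤ (m : ℝ) / (16 * M) := (abs_nonneg σ).trans hσm
  have h2 : |σ| * (16 * M) ≤ m := by rwa [← le_div_iff₀ (by positivity)]
  have h1 : (|σ| * (16 * M)) ^ 2 ≤ (m : ℝ) ^ 2 := pow_le_pow_left₀ (by positivity) h2 2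
  have e : (|σ| * (16 * M)) ^ 2 = 256 * (σ ^ 2 * M ^ 2) := by rw [mul_pow, sq_abs]; ring
  rw [e] at h1
  nlinarith [sq_nonneg σ, sq_nonneg M, mul_nonneg (sq_nonneg σ) (sq_nonneg M)]

set_option maxHeartbeats 400000 in
-- assembly of the explicit-constant theorem with the bookkeeping; large literal constants
/-- **The superradiant BF-stable cone kernel bound, Λ-polynomial constants (u-language).** GIVEN the
census (first hypothesis), for `M > 0`, `θ > 0`, `ξ₁ > 0`, `θ₁ > 0` there are `Λ₀`, `a₁ < M`, `ε₀ > 0`,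
`C > 0`, `N` such that the two-point bound holds for admissible `(ω, m, Λ)` with `0 < m`, `Λ₀ < Λ`,
`(1 + θ₁)(2r₊ω)² ≤ Λ − 2amω`, `|ω − mω₊| ≤ ε₀m`, `ω(ω − mω₊) ≤ 0`, `2ξ₁κ ≤ |ω − mω₊|`, every tortoise
radius, every pair with horizon/infinity data, and all `x ≤ x′` (the collar condition on `ρ x′` is not
used). [folklore] -/
theorem superradiantRegime_corePoly
    (hcensus : ∀ M : ℝ, 0 < M → ∃ a₁ ε₀ : ℝ, a₁ < M ∧ 0 < ε₀ ∧
      ∀ a : ℝ, a₁ ≤ |a| → IsSubextremal M a →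
        ∀ (ω : ℝ) (m : ℤ) (Λ : ℝ), IsAdmissibleTriple a ω m Λ → m ≠ 0 →
          |ω - m * horizonAngularVelocity M a| ≤ ε₀ * |(m : ℝ)| →
            (Ioi (rPlus M a) ∩ {r : ℝ | ω ^ 2 ≤ sepPotential M a ω m Λ r}).OrdConnected)
    {M : ℝ} (hM : 0 < M) {θ : ℝ} (_hθ : 0 < θ) {ξ₁ : ℝ} (hξ₁ : 0 < ξ₁) {θ₁ : ℝ} (hθ₁ : 0 < θ₁) :
    ∃ (Λ₀ a₁ ε₀ C : ℝ) (N : ℕ), a₁ < M ∧ 0 < ε₀ ∧ 0 < C ∧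
      ∀ a : ℝ, a₁ ≤ |a| → IsSubextremal M a →
        ∀ (ω : ℝ) (m : ℤ) (Λ : ℝ), IsAdmissibleTriple a ω m Λ → 0 < m → Λ₀ < Λ →
          (1 + θ₁) * (2 * rPlus M a * ω) ^ 2 ≤ Λ - 2 * a * m * ω →
          |ω - m * horizonAngularVelocity M a| ≤ ε₀ * |(m : ℝ)| →
          ω * (ω - m * horizonAngularVelocity M a) ≤ 0 →
          2 * ξ₁ * surfaceGravity M a ≤ |ω - m * horizonAngularVelocity M a| →
            ∀ ρ : ℝ → ℝ, IsTortoiseRadius M a ρ →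
            ∀ uH uH₁ uI uI₁ : ℝ → ℂ,
              (∀ x, HasDerivAt uH (uH₁ x) x ∧
                HasDerivAt uH₁ (-(((ω ^ 2 - sepPotential M a ω m Λ (ρ x) : ℝ) : ℂ) * uH x)) x) →
              (∀ x, HasDerivAt uI (uI₁ x) x ∧
                HasDerivAt uI₁ (-(((ω ^ 2 - sepPotential M a ω m Λ (ρ x) : ℝ) : ℂ) * uI x)) x) →
              Tendsto (fun x ↦ ‖uH x‖) atBot (𝓝 1) →
              Tendsto (fun x ↦ ‖uH₁ x‖) atBot (𝓝 |ω - m * horizonAngularVelocity M a|) →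
              (∀ x, (starRingEnd ℂ (uH x) * uH₁ x).im = -(ω - m * horizonAngularVelocity M a)) →
              Tendsto (fun x ↦ ‖uI x‖) atTop (𝓝 1) →
              Tendsto (fun x ↦ ‖uI₁ x‖) atTop (𝓝 |ω|) →
              (∀ x, (starRingEnd ℂ (uI x) * uI₁ x).im = ω) →
                ∀ x x' : ℝ, x ≤ x' → rPlus M a + θ * (rPlus M a - rMinus M a) ≤ ρ x' →
                  ‖uH x‖ * ‖uI x'‖ ≤
                    C * Λ ^ N * (surfaceGravity M a)⁻¹ ^ N * ‖uH x * uI₁ x - uI x * uH₁ x‖ := by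
  -- the margin may be taken `≤ 1`
  set θ₁' := min θ₁ 1 with hθ₁'def
  have hθ₁' : 0 < θ₁' := lt_min hθ₁ one_pos
  have hθ₁'1 : θ₁' ≤ 1 := min_le_right _ _
  have hθ₁'le : θ₁' ≤ θ₁ := min_le_left _ _
  -- census constants
  obtain ⟨a₁, ε₀, ha₁, hε₀, hcen⟩ := hcensus M hM
  -- the depth threshold (κ-free)
  set cB : ℝ := 64 * 678 * (7e4) ^ 16 with hcB
  set cG : ℝ := 677 + 1e4 * cB with hcG
  have hcG0 : 0 < cG := by rw [hcG, hcB]; positivity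
  have hMi : 0 < M⁻¹ := inv_pos.2 hM
  set AZ : ℝ := 32 * (1 + M + M⁻¹) ^ 4 * (1 + θ₁'⁻¹) with hAZ
  obtain ⟨Λd, hΛd1, hΛd⟩ := exists_forall_mul_pow_le_sinh (C := 64 * 3670016 * (2 + cB) * AZ ^ 110)
    (show 0 < θ₁' ^ 2 / 1200 by positivity) 110
  -- the flux-regime master constant with `δ = 2ξ₁`, enlarged by `1 + θ₁′⁻¹`
  set δ : ℝ := 2 * ξ₁ with hδdef
  have hδ : 0 < δ := by rw [hδdef]; positivity
  set AY : ℝ := 8 * (1 + M + M⁻¹) ^ 4 * (1 + δ⁻¹) * (1 + θ₁'⁻¹) with hAY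
  have hAY0 : 0 < AY := by rw [hAY]; positivity
  clear_value θ₁' cB cG AZ δ AY
  refine ⟨max (256 * 89600 / θ₁' ^ 3) Λd, max a₁ (M / 2), min ε₀ (θ₁' ^ 2 / (1088 * M)),
    24 * cG ^ 5 * AY ^ 545, 545, max_lt ha₁ (by linarith), lt_min hε₀ (by positivity), by positivity, ?_⟩
  intro a ha hsub ω m Λ hadm hm hΛ hBF hcone hωσ hflux ρ hρ uH uH₁ uI uI₁ hu hv hH0 hH1 hHf hI0 hI1 hIf x x'
    hxx' _
  have haM : |a| ≤ M := le_of_lt hsub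
  have ha2 : M / 2 ≤ |a| := le_trans (le_max_right _ _) ha
  have hεθ : min ε₀ (θ₁' ^ 2 / (1088 * M)) ≤ θ₁' ^ 2 / (1088 * M) := min_le_right _ _
  have hε16 : min ε₀ (θ₁' ^ 2 / (1088 * M)) ≤ 1 / (16 * M) := by
    refine hεθ.trans ?_
    rw [div_le_div_iff₀ (by positivity) (by positivity)]
    have : θ₁' ^ 2 ≤ 1 := pow_le_one₀ hθ₁'.le hθ₁'1
    nlinarith only [this, hM]
  have hκ : 0 < surfaceGravity M a := hsub.surfaceGravity_pos
  -- census, `ω ≠ 0`, `σ ≠ 0`, `Λ ≥ 1`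
  have hord : (Ioi (rPlus M a) ∩ {r : ℝ | ω ^ 2 ≤ sepPotential M a ω m Λ r}).OrdConnected :=
    hcen a ((le_max_left _ _).trans ha) hsub ω m Λ hadm hm.ne'
      (hcone.trans (mul_le_mul_of_nonneg_right (min_le_left _ _) (abs_nonneg _)))
  obtain ⟨-, -, hω0⟩ := cone_abs_omega_le_div hM haM ha2 hadm hm hε16 hcone
  have hm1 : (1 : ℝ) ≤ m := by exact_mod_cast hm
  have hΛ1 : 1 ≤ Λ := by nlinarith only [hadm.sq_le, hm1]
  have hσ0 : ω - m * horizonAngularVelocity M a ≠ 0 := by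
    intro e
    rw [e, abs_zero] at hflux
    have : 0 < δ * surfaceGravity M a := by positivity
    linarith only [this, hflux]
  have hωσ' : ω * (ω - m * horizonAngularVelocity M a) < 0 :=
    lt_of_le_of_ne hωσ (mul_ne_zero hω0 hσ0)
  obtain ⟨hσm, -, hσω⟩ := abs_sigma_le_abs_omega_of_cone hM haM ha2 hm hε16 hcone
  have hσΛ : (ω - m * horizonAngularVelocity M a) ^ 2 * M ^ 2 ≤ Λ := sigma_sq_mul_sq_le' hM hσm hadm.sq_le
  -- the margin with `θ₁'`, the smallness of `σ`, `Λ′` large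
  have hBF' : (1 + θ₁') * (2 * rPlus M a * ω) ^ 2 ≤ Λ - 2 * a * m * ω :=
    le_trans (mul_le_mul_of_nonneg_right (by linarith only [hθ₁'le]) (sq_nonneg _)) hBF
  have hσsmall := sigma_sq_le_of_cone_margin_sharp hM haM ha2 hm hθ₁' hθ₁'1 hεθ hcone hBF'
  have hΛ'256 := lambdaPrime_ge_of_margin hM haM ha2 hm hε16 hcone hθ₁'.le hBF'
  have hΛmin : 256 * 89600 / θ₁' ^ 3 ≤ Λ := le_trans (le_max_left _ _) hΛ.le
  have hΛ'z : 89600 ≤ θ₁' ^ 3 * (Λ - 2 * a * m * ω) := by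
    have h1 : 256 * 89600 ≤ θ₁' ^ 3 * Λ := by
      have := (div_le_iff₀ (by positivity : (0:ℝ) < θ₁' ^ 3)).1 hΛmin
      linarith only [this]
    have h2 : θ₁' ^ 3 * (Λ / 256) ≤ θ₁' ^ 3 * (Λ - 2 * a * m * ω) :=
      mul_le_mul_of_nonneg_left hΛ'256 (by positivity)
    linarith only [h1, h2]
  have hΛ'1 : 1 ≤ Λ - 2 * a * m * ω := by
    have : θ₁' ^ 3 * (Λ - 2 * a * m * ω) ≤ 1 * (Λ - 2 * a * m * ω) :=
      mul_le_mul_of_nonneg_right (pow_le_one₀ hθ₁'.le hθ₁'1) (by linarith only [hΛ'256, hΛ1])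
    linarith only [this, hΛ'z]
  -- the κ-free depth
  have hsinh := hΛd Λ (le_trans (le_max_right _ _) hΛ.le)
  rw [hAZ] at hsinh
  rw [hcB] at hsinh
  have hdeep := superradiantDepth_of_large hM haM ha2 hadm hm hε16 hcone hθ₁' hθ₁'1 hΛ'256 hsinh rfl rfl rfl
  -- the explicit-constant bound
  have key := superradiant_kernel_le hρ hsub hadm hΛ1 hσ0 hω0 hθ₁' hθ₁'1 hBF' hωσ' hσω hσsmall hΛ'z hσΛ hord
    hu hv hH0 hH1 hHf hI0 hI1 hIf rfl rfl rfl rfl rfl rfl rfl rfl rfl rfl rfl rfl hdeep hxx'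
  refine key.trans (mul_le_mul_of_nonneg_right ?_ (norm_nonneg _))
  clear key hdeep hsinh hΛd hu hv hH0 hH1 hHf hI0 hI1 hIf hxx' hcen hord
  -- bookkeeping: every atom is a power of `Y`
  set Y := 8 * (1 + M + M⁻¹) ^ 4 * (1 + δ⁻¹) * Λ / surfaceGravity M a with hYdef
  have hat : 1 ≤ Y ∧ |ω - m * horizonAngularVelocity M a|⁻¹ ≤ Y ∧
      (ω - m * horizonAngularVelocity M a) ^ 2 ≤ Y ^ 2 ∧ |ω| ≤ Y ∧ |ω|⁻¹ ≤ Y ∧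
      (min δ 1 * surfaceGravity M a / 2)⁻¹ ≤ Y ∧ (min δ 1 * surfaceGravity M a / 2) ^ 2 ≤ Y ∧ Λ ≤ Y ∧
      (surfaceGravity M a)⁻¹ ≤ Y ∧ M ≤ Y ∧ M⁻¹ ≤ Y ∧ (M ^ 2)⁻¹ ≤ Y :=
    coneMaster_bounds hsub ha2 hadm hm hε16 hcone hδ hflux
  obtain ⟨hY1, hσi, -, hωY, hωi, -, -, hΛY, hκi, hMY, hMiY, hM2i⟩ := hat
  set Y' := AY * Λ / surfaceGravity M a with hY'def
  have hYY' : Y' = (1 + θ₁'⁻¹) * Y := by rw [hY'def, hYdef, hAY]; ring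
  have hθi : 0 < θ₁'⁻¹ := inv_pos.2 hθ₁'
  have hYle : Y ≤ Y' := by
    rw [hYY']; exact le_mul_of_one_le_left (by linarith only [hY1]) (by linarith only [hθi])
  have hY'1 : 1 ≤ Y' := hY1.trans hYle
  have hθ₁Y : θ₁'⁻¹ ≤ Y' := by
    rw [hYY']
    calc θ₁'⁻¹ ≤ 1 + θ₁'⁻¹ := by linarith only
      _ = (1 + θ₁'⁻¹) * 1 := (mul_one _).symm
      _ ≤ (1 + θ₁'⁻¹) * Y := mul_le_mul_of_nonneg_left hY1 (by linarith only [hθi])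
  have hY'pow : Y' ^ 545 = AY ^ 545 * Λ ^ 545 * (surfaceGravity M a)⁻¹ ^ 545 := by
    rw [hY'def, div_eq_mul_inv, mul_pow, mul_pow]
  clear_value Y Y'
  have hrp0 : 0 < rPlus M a := rPlus_pos hM a
  have hrp2 : rPlus M a ≤ 2 * M := rPlus_le_two_mul_self hM.le a
  have hKle := superradiantKernelConstant_le_pow hY'1 hσ0 hω0 hσω (hωY.trans hYle) (hσi.trans hYle)
    (hωi.trans hYle) hκ (hκi.trans hYle) hM (hMY.trans hYle) (hMiY.trans hYle) (hM2i.trans hYle) hθ₁' hθ₁'1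
    hθ₁Y hΛ1 (hΛY.trans hYle) hΛ'1 hrp0 hrp2 hσΛ rfl rfl rfl rfl rfl rfl rfl rfl rfl rfl rfl
  rw [← hcB, ← hcG, hY'pow] at hKle
  calc _ ≤ 24 * cG ^ 5 * (AY ^ 545 * Λ ^ 545 * (surfaceGravity M a)⁻¹ ^ 545) := hKle
    _ = 24 * cG ^ 5 * AY ^ 545 * Λ ^ 545 * (surfaceGravity M a)⁻¹ ^ 545 := by ring

end SuperradiantCorePoly

end Kerr

end Literature.Geometry.Lorentzian

end
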